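import Mathlib
import HarnessLib
import HarnessLib.Audit
import Summits.QuantumAdvantage.Statement
import Summits.QuantumAdvantage.AdviceFreeQNC0.AdviceFreeQNC0
import Summits.QuantumAdvantage.AdviceFreeQNC0.RingHardOdd
import Summits.QuantumAdvantage.AdviceFreeQNC0.AdviceFreeQNC0Three
import Summits.QuantumAdvantage.AdviceFreeQNC0.KernelFibrationMoves
import Summits.QuantumAdvantage.AdviceFreeQNC0.RingFlipMap
import Summits.QuantumAdvantage.QuantumAdvantage.Theorems.RingFrameBridge
import Literature.Computability.MetaComplexity.SmolenskyProperty

/-!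
# WildDialDoll — rescue law, doll annihilator, period-3 padding, residue law and the uniform doll family:
# `canonCoin3` — NO CONSTANT-DEGREE `𝔽₃`-EVENT COMPLETES THE CANONICAL AFFINE BASE (decomp-qadv lens 1, generation 5; TREE-READY)

Self-contained support file over tree modules only (no route decls): proposed landing target
`Summits/QuantumAdvantage/QuantumAdvantage/Theorems/WildDialDoll.lean` (`--supports stmt-QuantumAdvantage-27380`; it proves the
canonical-base instance of 27380 `NoPerfectConst3` FOR EVERY DEGREE `d` and all ring lengths `n ≥ 12d+6` — `canonCoin3`,
`canonCoinAt_of_le` — hence also of 27432 `NoPerfectTwo3`).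
Contents = §2–§4e of the node file `HOME/decomp-qadv-lens-1/g5/WildDial.lean` verbatim (namespace renamed; the `d = 4` kernel
certificates of §4c omitted):

* §2 RESCUE LAW: `canonStrat`, `rel_canonStrat_iff`, `rel_canonStrat_of_coin`, `oracleBit`, `canon_oracle_perfect` (one arbitrary
  wild bit makes the canonical affine base perfect on the odd class), `canon_perfect_iff`; §2a `canonPoly`, `decide_canonPoly`,
  `CanonCoinAt n d` («no degree-`d` wild event completes the canonical base at length `n`»), `CanonCoin3`.
* §3 DOLL ANNIHILATOR `dollSum_eq_zero_of_mem_lowDeg` (any field: the `m`-th iterated difference along `m > deg P` disjoint flip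
  sets kills `P`), §3a event form `dollSum_event` (𝔽₃, Smolensky squaring), `DollWitness`, `canonCoinAt_of_dollWitness`.
* §4a PERIOD-3 PADDING: `pad3`, `padVec`, `inKernel_pad3`, `kline_pad3 : kline (pad3 x) = padVec (kline x)`, `isOdd_pad3`,
  `oracleBit_pad3_zero`, `dollWitness_pad3` (witnesses transport `n ↦ n + 3`).
* §4 nine kernel certificates (`decide +kernel`), §4b `canonCoinAt_one : 8 ≤ n → CanonCoinAt n 1`,
  **`canonCoinAt_two : 12 ≤ n → CanonCoinAt n 2`**, **`canonCoinAt_three : 16 ≤ n → CanonCoinAt n 3`**, `canonQuadratic3`, `canonCubic3`.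
* §4c the uniform family `famX N z = 1^N` with one zero at `z`, nested dolls `famT N d j = {4+3j, 12d+5−3j}`, tuning `famZ N ∈ {1,2,3}`,
  `FamilyWitness`, `canonCoin3_of_familyWitness`.
* §4e ITS PROOF in the tree's monodromy coordinates: `reflBit_append`, `sigmaSum_append`, the shell word `nest` (`length_nest`,
  `reflBit_nest`, `sigmaSum_nest`, `nest_getD_eq_false_iff`), `famWord`, the bridge `ofFn_dollPt_fam : List.ofFn (dollPt …) = famWord …`,
  `sigmaSum_famWord`, `famZ_spec`, `paritySum_ne_zero`, **`familyWitness`**, **`canonCoin3 : CanonCoin3`**,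
  **`canonCoinAt_of_le : 12d+6 ≤ n → CanonCoinAt n d`**.
* §4d RESIDUE LAW: `rel_canonStrat_zero_iff_sig` (on the odd class, `Rel x (canonStrat 0 w x) ⟺ σ = 0 ∨ (σ = 1 ∧ w x = x₁) ∨ (σ = 2 ∧ w x = ¬x₁)`,
  `σ = sigmaSum (List.ofFn x)`), `canonCoinAt_iff_sig` (`CanonCoinAt n d ⟺` no degree-`d` level set separates `σ = 1` from `σ = 2` on the
  odd class up to the twist `x₁`).

Farm `lean check`: rc 0 · 0 sorry · 0 warnings (≈ 25 s); axioms {propext, Classical.choice, Quot.sound}.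
-/

set_option linter.dupNamespace false

namespace Summit.QuantumAdvantage.QuantumAdvantage.Theorems.WildDialDoll

open Finset
open Summit.QuantumAdvantage.AdviceFreeQNC0
open Summit.QuantumAdvantage.AdviceFreeQNC0.Fib19
open Literature.Computability.QuantumComplexity
open Literature.Computability.QuantumComplexity.RingHLF
open Literature.Computability.MetaComplexity

/-! ### §2 The rescue law: ONE ARBITRARY BIT SUFFICES (the arbitrary-wild axis is degenerate) -/

section Canon

variable {n : ℕ}

/-- **The canonical one-wild strategy at pin `p`**: the canonical guess `t(x)_i = x_i ⊕ x_{i+1}` everywhere, the output at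
`p + 1` NEGATED, and the output at `p` replaced by the wild bit `w x`.  All outputs except `p` are affine events
(`canonPoly_mem_lowDeg_one`). [NEW object of this node] -/
def canonStrat (p : Fin n) (w : (Fin n → Bool) → Bool) (x : Fin n → Bool) : Fin n → Bool :=
  fun i => if i = p then w x else if i = nxt p then !(tGuess x i) else tGuess x i

/-- The stake (deviation from the canonical guess) of the canonical one-wild strategy: `1` at `p+1`, the bit
`w x ⊕ t(x)_p` at `p`, `0` elsewhere. [bookkeeping] -/
theorem stake_canonStrat (hn : 3 ≤ n) (p : Fin n) (w : (Fin n → Bool) → Bool) (x : Fin n → Bool) :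
    stake (canonStrat p w) x =
      fun i => xor (decide (i = nxt p)) (decide (i = p) && xor (w x) (tGuess x p)) := by
  have hpn : nxt p ≠ p := nxt_ne_self (by omega) p
  funext i
  unfold stake canonStrat
  by_cases hip : i = p
  · subst hip
    simp [hpn.symm]
  · by_cases hin : i = nxt p
    · subst hin
      simp [hpn]
    · simp [hip, hin]

/-- `⟨v, 𝟙_{p} ∧ c⟩ mod 2 = [v_p ∧ c]`. [bookkeeping] -/
theorem dot2_single (v : Fin n → Bool) (p : Fin n) (c : Bool) :
    dot2 v (fun i => decide (i = p) && c) = if (v p && c) = true then 1 else 0 := by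
  unfold dot2
  rw [Finset.card_filter, Finset.sum_eq_single p (fun b _ hb => by simp [hb]) (by simp)]
  cases v p <;> cases c <;> simp

/-- `⟨v, 𝟙_{p}⟩ mod 2 = [v_p]`. [bookkeeping] -/
theorem dot2_indicator (v : Fin n → Bool) (p : Fin n) :
    dot2 v (fun i => decide (i = p)) = if v p = true then 1 else 0 := by
  have h := dot2_single v p true
  simp only [Bool.and_true] at h
  exact h

/-- **WIN LAW of the canonical one-wild strategy** (from the tree's stake form `Fib19.rel_iff_stake`): on an odd pattern `x`
with kernel line `J = kline x`, `canonStrat p w` wins iff `J_{p+1} ⊕ (J_p ∧ (w x ⊕ t(x)_p)) = 1`. [PROVED] -/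
theorem rel_canonStrat_iff (hn : 3 ≤ n) (p : Fin n) (w : (Fin n → Bool) → Bool) (x : Fin n → Bool) (hodd : IsOdd x) :
    Rel x (canonStrat p w x) ↔ (xor (kline x (nxt p)) (kline x p && xor (w x) (tGuess x p))) = true := by
  rw [rel_iff_stake hn (canonStrat p w) x hodd, stake_canonStrat hn p w x,
    show (fun i => xor (decide (i = nxt p)) (decide (i = p) && xor (w x) (tGuess x p))) =
      fun i => xor ((fun k => decide (k = nxt p)) i) ((fun k => decide (k = p) && xor (w x) (tGuess x p)) i) from rfl,
    dot2_xor_right, dot2_indicator, dot2_single]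
  cases kline x (nxt p) <;> cases kline x p <;> cases xor (w x) (tGuess x p) <;> simp

/-- **THE PIN CLASS IS AFFINELY SOLVED**: if `p` is a coin of `x` (`J_p = 0`) then the canonical one-wild strategy wins at
`x` WHATEVER the wild bit is (hard-core: `J_{p+1} = 1`).  So the affine strategy «canonical guess with output `p+1` negated»
wins on the whole pin class `{x odd : J_p(x) = 0}` (density `≈ 1/3`): one ARBITRARY wild output at `p` rescues it, and the
arbitrary-wild ladder stops at `q = 1`.  NEGATIVE KNOWLEDGE: «no affine strategy wins on a pin class» is FALSE — pinned
classes are never admissible hardness leaves. [PROVED] -/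
theorem rel_canonStrat_of_coin (hn : 3 ≤ n) (p : Fin n) (w : (Fin n → Bool) → Bool) (x : Fin n → Bool) (hodd : IsOdd x)
    (hp : kline x p = false) : Rel x (canonStrat p w x) := by
  rw [rel_canonStrat_iff hn p w x hodd, hp, (kline_hardCore hn x hodd).nxt_eq_true hp]
  simp

/-- The ORACLE wild bit: `t(x)_p ⊕ ¬J_{p+1}(x)` — the coin indicator of the right neighbour, up to a literal. [NEW object] -/
def oracleBit (p : Fin n) (x : Fin n → Bool) : Bool := xor (tGuess x p) (!kline x (nxt p))

/-- **ONE BIT SUFFICES**: with the oracle wild bit the canonical one-wild strategy is PERFECT on the odd class, for every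
ring length `n ≥ 3` and every pin `p`.  The whole `𝔽₃`-exactness obstruction of the odd-class ring game is therefore
concentrated in ONE Boolean function, the coin indicator `x ↦ J_{p+1}(x)` (a `MOD 3` event of the domain-wall magnetisation,
NODE-g5.md §3). [PROVED] -/
theorem canon_oracle_perfect (hn : 3 ≤ n) (p : Fin n) (x : Fin n → Bool) (hodd : IsOdd x) :
    Rel x (canonStrat p (oracleBit p) x) := by
  rw [rel_canonStrat_iff hn p _ x hodd, oracleBit]
  cases hJ1 : kline x (nxt p)
  · have hJp : kline x p = true := by
      have h := (kline_hardCore hn x hodd).prv_eq_true hJ1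
      rwa [prv_nxt] at h
    rw [hJp]; cases tGuess x p <;> simp
  · cases tGuess x p <;> cases kline x p <;> simp

/-- **PERFECTION CRITERION = THE FORCED BIT**: the canonical one-wild strategy with wild bit `w` is perfect on the odd class
iff `w` agrees with the oracle bit on the co-pin class `{x odd : J_p(x) = 1}` (on the pin class it is free). [PROVED] -/
theorem canon_perfect_iff (hn : 3 ≤ n) (p : Fin n) (w : (Fin n → Bool) → Bool) :
    (∀ x : Fin n → Bool, IsOdd x → Rel x (canonStrat p w x)) ↔
      ∀ x : Fin n → Bool, IsOdd x → kline x p = true → w x = oracleBit p x := by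
  refine forall_congr' fun x => forall_congr' fun hodd => ?_
  rw [rel_canonStrat_iff hn p w x hodd, oracleBit]
  constructor
  · intro h hJp
    rw [hJp] at h
    revert h
    cases kline x (nxt p) <;> cases w x <;> cases tGuess x p <;> simp
  · intro h
    cases hJp : kline x p
    · rw [(kline_hardCore hn x hodd).nxt_eq_true hJp]; simp
    · rw [h hJp]
      cases kline x (nxt p) <;> cases tGuess x p <;> simp

/-! ### §2a The canonical one-wild strategy IS a `(d,1)`-cell strategy -/

/-- The polynomial tuple realising `canonStrat p [P₀ = 1]`: `P₀` at `p`; `x_{p+1} + 2x_{p+2} + 1` at `p + 1` (its event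
`[· = 1]` is `¬(x_{p+1} ⊕ x_{p+2})`); `x_i + x_{i+1}` elsewhere (event `x_i ⊕ x_{i+1} = t(x)_i`). [bookkeeping] -/
def canonPoly (p : Fin n) (P₀ : Smolensky.CubeFn (ZMod 3) n) : Fin n → Smolensky.CubeFn (ZMod 3) n :=
  fun i => if i = p then P₀
    else if i = nxt p then Smolensky.mono (ZMod 3) {nxt p} + (2 : ZMod 3) • Smolensky.mono (ZMod 3) {nxt (nxt p)} + 1
    else Smolensky.mono (ZMod 3) {i} + Smolensky.mono (ZMod 3) {nxt i}

/-- Constants are affine. [bookkeeping] -/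
theorem one_mem_lowDeg (n d : ℕ) : (1 : Smolensky.CubeFn (ZMod 3) n) ∈ Smolensky.lowDeg (ZMod 3) n d := by
  rw [← Smolensky.mono_empty]
  exact Smolensky.mono_mem_lowDeg (by simp)

/-- All outputs of `canonPoly` except the wild one are affine. [PROVED] -/
theorem canonPoly_mem_lowDeg_one (p : Fin n) (P₀ : Smolensky.CubeFn (ZMod 3) n) {i : Fin n} (hi : i ≠ p) :
    canonPoly p P₀ i ∈ Smolensky.lowDeg (ZMod 3) n 1 := by
  unfold canonPoly
  rw [if_neg hi]
  have hm : ∀ j : Fin n, Smolensky.mono (ZMod 3) {j} ∈ Smolensky.lowDeg (ZMod 3) n 1 :=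
    fun j => Smolensky.mono_mem_lowDeg (by simp)
  split_ifs
  · exact Submodule.add_mem _ (Submodule.add_mem _ (hm _) (Submodule.smul_mem _ _ (hm _))) (one_mem_lowDeg n 1)
  · exact Submodule.add_mem _ (hm _) (hm _)

/-- The wild output of `canonPoly` is `P₀`. [bookkeeping] -/
@[simp] theorem canonPoly_self (p : Fin n) (P₀ : Smolensky.CubeFn (ZMod 3) n) : canonPoly p P₀ p = P₀ := by
  simp [canonPoly]

/-- A singleton monomial is the bit. [bookkeeping] -/
theorem mono_singleton_apply (j : Fin n) (x : Fin n → Bool) :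
    Smolensky.mono (ZMod 3) {j} x = if x j = true then 1 else 0 := by
  rw [Smolensky.mono_apply]; simp

/-- The two affine gadgets evaluate to the canonical guess and its negation. [bookkeeping] -/
theorem gadget_tables : ∀ a b : Bool,
    (decide (((if a = true then (1 : ZMod 3) else 0) + (if b = true then (1 : ZMod 3) else 0)) = 1) = xor a b) ∧
    (decide (((if a = true then (1 : ZMod 3) else 0) + (2 : ZMod 3) • (if b = true then (1 : ZMod 3) else 0) + 1) = 1) = !(xor a b)) := by
  decide

/-- **`canonPoly` realises `canonStrat`**: the event tuple of `canonPoly p P₀` is the canonical one-wild strategy with wild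
bit `[P₀ x = 1]`. [PROVED] -/
theorem decide_canonPoly (p : Fin n) (P₀ : Smolensky.CubeFn (ZMod 3) n) (x : Fin n → Bool) :
    (fun i => decide (canonPoly p P₀ i x = 1)) = canonStrat p (fun y => decide (P₀ y = 1)) x := by
  funext i
  unfold canonPoly canonStrat
  by_cases hip : i = p
  · simp [hip]
  · rw [if_neg hip, if_neg hip]
    by_cases hin : i = nxt p
    · rw [if_pos hin, if_pos hin]
      simp only [Pi.add_apply, Pi.smul_apply, Pi.one_apply, mono_singleton_apply, tGuess, hin]
      exact (gadget_tables _ _).2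
    · rw [if_neg hin, if_neg hin]
      simp only [Pi.add_apply, mono_singleton_apply, tGuess]
      exact (gadget_tables _ _).1

/-- **`CanonCoinAt n d`** — the canonical-base instance of the `(d,1)`-cell at ring length `n` (pin `p = 0`): no wild bit of
the form `[P₀ x = 1]` with `deg P₀ ≤ d` makes the canonical one-wild strategy perfect on the odd class; by
`canon_perfect_iff`, equivalently: THE ORACLE BIT `t(x)_0 ⊕ ¬J_1(x)` IS NOT A DEGREE-`d` `𝔽₃`-EVENT ON THE CO-PIN CLASS
`{x odd : J_0(x) = 1}`. [NEW; decidable in principle at each `n`; certified by doll witnesses (§3–§4)] -/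
def CanonCoinAt (n d : ℕ) : Prop :=
  ∀ h3 : 3 ≤ n, ∀ P₀ : Smolensky.CubeFn (ZMod 3) n, P₀ ∈ Smolensky.lowDeg (ZMod 3) n d →
    ∃ x : Fin n → Bool, OddZeros x ∧
      ¬ RingHLF.Rel x (canonStrat (⟨0, by omega⟩ : Fin n) (fun y => decide (P₀ y = 1)) x)

/-- **ATTACK LEAF `CanonCoin3`**: for every constant `d`, for all large `n`, `CanonCoinAt n d`. [NECESSARY for P1
(`canonCoin3_of_oneWildConst3`), hence WEAKER than P1, than the cell column and than the target — and **PROVED IN THIS FILE FOR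
EVERY `d`** (`theorem canonCoin3`, §4e, `n₀ = 12d+6`; sharper `n₀ = 8 / 12 / 16` at `d ≤ 3`, §4b) by the DOLL METHOD — a Russian
doll of `2d+1` nested pair flips on which the doll functional of the oracle bit is non-zero while it vanishes on every
degree-`2d` polynomial (`dollSum_eq_zero_of_mem_lowDeg`, `canonCoinAt_of_dollWitness`) — applied to the UNIFORM FAMILY
`famX/famT/famZ` via the RESIDUE LAW (§4d: on the odd class the game on the canonical base is decided by the monodromy residue
`σ(x) ∈ ℤ/3`).  Sources: this file §3–§4e; R. Smolensky, STOC 1987 (the `(P−1)²` squaring trick); tree `kernelLine_zero_one`,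
`Fib19.kline_hardCore`.] -/
def CanonCoin3 : Prop := ∀ d : ℕ, ∃ n₀ : ℕ, ∀ n ≥ n₀, CanonCoinAt n d

end Canon

/-! ### §3 The doll annihilator (NEW tool): high-order pair-flip differences kill low-degree polynomials -/

section Doll

variable {F : Type*} [Field F] {n m : ℕ}

/-- **Doll point**: the pattern `x` flipped on the union of the chosen flip sets `T k`, `k ∈ S`.  With `|T k|` even the odd
class is preserved (`Fib19.isOdd_flipAt_of_even`); with the `T k = {a_k, b_k}` NESTED (`a₁ < ⋯ < a_m < b_m < ⋯ < b₁`) the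
domain-wall magnetisation of `x^S` depends on the PREFIX PARITIES of `S` (NODE-g5.md §3) — the Russian doll. [NEW object] -/
def dollPt (x : Fin n → Bool) (T : Fin m → Finset (Fin n)) (S : Finset (Fin m)) : Fin n → Bool :=
  flipAt x (S.biUnion T)

/-- **The doll functional** `Φ_{x,T}(P) = Σ_{S ⊆ [m]} (−1)^{|S|} P(x^S)` — the `m`-th iterated difference of `P` along the
`m` commuting flips. [NEW object] -/
def dollSum (x : Fin n → Bool) (T : Fin m → Finset (Fin n)) (P : Smolensky.CubeFn F n) : F :=
  ∑ S : Finset (Fin m), (-1 : F) ^ S.card * P (dollPt x T S)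

/-- The toggle of one flip index. [bookkeeping] -/
def toggle (k₀ : Fin m) (S : Finset (Fin m)) : Finset (Fin m) := if k₀ ∈ S then S.erase k₀ else insert k₀ S

/-- WildDial doll helper `toggle_toggle` (lens-1 g5 WildDialDoll; see the enclosing section docstring). -/
theorem toggle_toggle (k₀ : Fin m) (S : Finset (Fin m)) : toggle k₀ (toggle k₀ S) = S := by
  unfold toggle
  by_cases h : k₀ ∈ S
  · rw [if_pos h, if_neg (Finset.notMem_erase k₀ S), Finset.insert_erase h]
  · rw [if_neg h, if_pos (Finset.mem_insert_self k₀ S), Finset.erase_insert h]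

/-- WildDial doll helper `toggle_ne` (lens-1 g5 WildDialDoll; see the enclosing section docstring). -/
theorem toggle_ne (k₀ : Fin m) (S : Finset (Fin m)) : toggle k₀ S ≠ S := by
  unfold toggle
  by_cases h : k₀ ∈ S
  · rw [if_pos h]; exact fun e => Finset.notMem_erase k₀ S (e.symm ▸ h)
  · rw [if_neg h]; exact fun e => h (e ▸ Finset.mem_insert_self k₀ S)

/-- Toggling changes the sign. [bookkeeping] -/
theorem neg_one_pow_card_toggle (k₀ : Fin m) (S : Finset (Fin m)) :
    (-1 : F) ^ (toggle k₀ S).card = -(-1 : F) ^ S.card := by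
  unfold toggle
  by_cases h : k₀ ∈ S
  · rw [if_pos h, Finset.card_erase_of_mem h]
    obtain ⟨c, hc⟩ : ∃ c, S.card = c + 1 := ⟨S.card - 1, by have := Finset.card_pos.2 ⟨k₀, h⟩; omega⟩
    rw [hc, Nat.add_sub_cancel, pow_succ]; ring
  · rw [if_neg h, Finset.card_insert_of_notMem h, pow_succ]; ring

/-- Toggling an index whose flip set misses position `i` does not move the doll point at `i`. [bookkeeping] -/
theorem dollPt_toggle_apply (x : Fin n → Bool) (T : Fin m → Finset (Fin n)) {k₀ : Fin m} {i : Fin n} (hi : i ∉ T k₀)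
    (S : Finset (Fin m)) : dollPt x T (toggle k₀ S) i = dollPt x T S i := by
  have key : (i ∈ (toggle k₀ S).biUnion T) ↔ (i ∈ S.biUnion T) := by
    simp only [Finset.mem_biUnion]
    unfold toggle
    constructor
    · rintro ⟨k, hk, hik⟩
      have hkk : k ≠ k₀ := fun e => hi (e ▸ hik)
      by_cases h : k₀ ∈ S
      · rw [if_pos h] at hk; exact ⟨k, (Finset.mem_erase.1 hk).2, hik⟩
      · rw [if_neg h] at hk
        rcases Finset.mem_insert.1 hk with e | hk'
        · exact absurd e hkk
        · exact ⟨k, hk', hik⟩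
    · rintro ⟨k, hk, hik⟩
      have hkk : k ≠ k₀ := fun e => hi (e ▸ hik)
      by_cases h : k₀ ∈ S
      · rw [if_pos h]; exact ⟨k, Finset.mem_erase.2 ⟨hkk, hk⟩, hik⟩
      · rw [if_neg h]; exact ⟨k, Finset.mem_insert_of_mem hk, hik⟩
  unfold dollPt flipAt
  rw [show decide (i ∈ (toggle k₀ S).biUnion T) = decide (i ∈ S.biUnion T) from by rw [decide_eq_decide]; exact key]

/-- A monomial missed by the flip set `T k₀` is invariant under toggling `k₀`. [bookkeeping] -/
theorem mono_dollPt_toggle (x : Fin n → Bool) (T : Fin m → Finset (Fin n)) (U : Finset (Fin n)) {k₀ : Fin m}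
    (hk : Disjoint (T k₀) U) (S : Finset (Fin m)) :
    Smolensky.mono F U (dollPt x T (toggle k₀ S)) = Smolensky.mono F U (dollPt x T S) := by
  unfold Smolensky.mono
  refine Finset.prod_congr rfl fun i hi => ?_
  rw [dollPt_toggle_apply x T (Finset.disjoint_right.1 hk hi) S]

/-- **Pigeonhole**: `m` pairwise disjoint flip sets cannot all meet a set of fewer than `m` positions. [bookkeeping] -/
theorem exists_disjoint_of_card_lt (T : Fin m → Finset (Fin n)) (hT : Pairwise fun k l => Disjoint (T k) (T l))
    (U : Finset (Fin n)) (hU : U.card < m) : ∃ k₀, Disjoint (T k₀) U := by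
  by_contra h
  push Not at h
  choose f hf using fun k => Finset.not_disjoint_iff.1 (h k)
  have hinj : Function.Injective f := by
    intro k l hkl
    by_contra hne
    exact Finset.disjoint_left.1 (hT hne) (hf k).1 (hkl ▸ (hf l).1)
  have hsub : Finset.univ.image f ⊆ U := by
    intro i hi
    obtain ⟨k, _, rfl⟩ := Finset.mem_image.1 hi
    exact (hf k).2
  have h1 := Finset.card_le_card hsub
  rw [Finset.card_image_of_injective _ hinj, Finset.card_univ, Fintype.card_fin] at h1
  omega

/-- Linearity of the doll functional. [bookkeeping] -/
theorem dollSum_add (x : Fin n → Bool) (T : Fin m → Finset (Fin n)) (P Q : Smolensky.CubeFn F n) :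
    dollSum x T (P + Q) = dollSum x T P + dollSum x T Q := by
  unfold dollSum
  rw [← Finset.sum_add_distrib]
  exact Finset.sum_congr rfl fun S _ => by rw [Pi.add_apply, mul_add]

/-- WildDial doll helper `dollSum_smul` (lens-1 g5 WildDialDoll; see the enclosing section docstring). -/
theorem dollSum_smul (x : Fin n → Bool) (T : Fin m → Finset (Fin n)) (a : F) (P : Smolensky.CubeFn F n) :
    dollSum x T (a • P) = a * dollSum x T P := by
  unfold dollSum
  rw [Finset.mul_sum]
  exact Finset.sum_congr rfl fun S _ => by rw [Pi.smul_apply, smul_eq_mul]; ring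

/-- **THE DOLL ANNIHILATOR.** If `P` has degree `≤ D` and `T` consists of `m > D` pairwise disjoint flip sets, then
`Σ_{S ⊆ [m]} (−1)^{|S|} P(x^S) = 0`: every monomial of `P` misses some `T k₀` (pigeonhole), and toggling `k₀` is a
sign-reversing involution fixing its value. (Any field; no use of the ring.) [PROVED; NEW tool] -/
theorem dollSum_eq_zero_of_mem_lowDeg (x : Fin n → Bool) (T : Fin m → Finset (Fin n))
    (hT : Pairwise fun k l => Disjoint (T k) (T l)) {D : ℕ} (hDm : D < m) {P : Smolensky.CubeFn F n}
    (hP : P ∈ Smolensky.lowDeg F n D) : dollSum x T P = 0 := by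
  rw [Smolensky.lowDeg_eq_span] at hP
  refine Submodule.span_induction ?_ ?_ ?_ ?_ hP
  · rintro _ ⟨⟨U, hU⟩, rfl⟩
    obtain ⟨k₀, hk₀⟩ := exists_disjoint_of_card_lt T hT U (lt_of_le_of_lt hU hDm)
    unfold dollSum
    refine Finset.sum_involution (fun S _ => toggle k₀ S) (fun S _ => ?_) (fun S _ _ => toggle_ne k₀ S)
      (fun S _ => Finset.mem_univ _) (fun S _ => toggle_toggle k₀ S)
    dsimp only
    rw [mono_dollPt_toggle x T U hk₀ S, neg_one_pow_card_toggle]; ring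
  · unfold dollSum; simp
  · intro P Q _ _ hP hQ; rw [dollSum_add, hP, hQ, add_zero]
  · intro a P _ hP; rw [dollSum_smul, hP, mul_zero]

end Doll

/-! ### §3a The event form over `𝔽₃` (Smolensky's squaring trick) and the reduction of `CanonCoinAt` to doll witnesses -/


end Summit.QuantumAdvantage.QuantumAdvantage.Theorems.WildDialDoll
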